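import Summits.ResolutionOfSingularities.KangarooAtlas.MizutaniAttainedGeneralOmega
import HarnessLib

/-!
# Mizutani's `m(e)` — attainment over an ARBITRARY field, III: the invariant forms of `attP` are one-dimensional

Cell topic `Summits/ResolutionOfSingularities/KangarooAtlas` (pub-rosobs); namespace
`Summit.ResolutionOfSingularities.KangarooAtlas.Mizutani.GenAtt`.  Part of the Lean transcription of the in-house
note MIZUTANI-PROOF-g59 (AI-written, AI-audited; *AI review is weaker than expert review*; NOT a resolution theorem).
General-field attainment, step III (the general-field copy of encloser-1's `MizutaniAttainedForms.lean`): for a field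
`k` of characteristic `p`, a `p`-independent pair `u : Fin 2 → k`, `q = p^e`, `e ≥ 1`, and the point
`attP k p e u ⊂ k[X_0, …, X_N]` (`N + 1 = 2q`) of part I,

* `attKey` — if `Σ_i a_i (u + X)^{p^m W_i}` only has monomials of degree `≥ p^m q` then `a = a_{i*} · attV m`
  (top homogeneous component + the substitution `X ↦ X − u`; verbatim the argument of encloser-1, any field);
* `invForms_attP_le_span` — `(L_B)_{e+m}(attP) ⊆ k · attV m`, so `dim_k (L_B)_{e+m} ≤ 1` (via part II);
* `attS_eq` — `Σ_{j<q} u_1^{q−1−j} ⊗ u_1^j = (1 ⊗ u_1 − u_1 ⊗ 1)^{q−1}` in `k ⊗_{k^q} k`, here from the POLYNOMIAL identity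
  `Σ_j X_0^{q−1−j} X_1^j = (X_1 − X_0)^{q−1}` in `k[X_0, X_1]` (characteristic `p`; no tower needed);
* `attA0_mem_invForms`, `finrank_invForms_attP` — the left coefficients `a⁰` of `ω = t_0 t_1^{q−1}` form a basis of
  `(L_B)_e(attP)`: `dim_k (L_B)_e = 1`.

References: [Mizutani1973HironakaGroupSchemes] Remark 2.10 (`dim H_e = 2p^e − 1`), Example 2.1; in-house note §10,
Cor. 10.1; [Oda1983HironakaGroupSchemeII] §2 (p. 1168).
-/

open MvPolynomial TensorProduct Literature.AlgebraicGeometry.Resolution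
  Literature.AlgebraicGeometry.Resolution.HironakaScheme

namespace Summit.ResolutionOfSingularities.KangarooAtlas.Mizutani.GenAtt

universe u

section Key

variable {k : Type u} [Field k] {p e : ℕ} [hp : Fact p.Prime] [CharP k p] {u : Fin 2 → k}

variable (k p e u) in
/-- The reference vector `attV m`: the coefficients of `(X − u)^{p^m W_{i*}}` at the exponents `p^m W_i` — the unique
(up to scalars) solution of the key estimate. [folklore] -/
noncomputable def attV (m : ℕ) (i : Fin (attN p e + 1)) : k :=
  coeff (p ^ m • attW p e i)
    (aeval (fun l => (X l - C (u l) : MvPolynomial (Fin 2) k))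
      (monomial (p ^ m • attW p e (attTop (p := p) (e := e))) (1 : k)))

omit [CharP k p] in
/-- **KEY ESTIMATE** (any field): if `P = Σ_i a_i (u + X)^{p^m W_i}` only has monomials of degree `≥ p^m q`, then
`a = a_{i*} · attV m`.  (`totalDegree P ≤ p^m q`, so `P` is its own top component `= a_{i*} X^{p^m W_{i*}}`; substitute
`X ↦ X − u` and compare coefficients.)  Proof verbatim from encloser-1's `attKey`.
[cite: Mizutani1973HironakaGroupSchemes, Remark 2.10 (dim H_e = 2p^e − 1: the invariant forms of H_e are one-dimensional)] -/
theorem attKey (m : ℕ) (a : Fin (attN p e + 1) → k)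
    (hdeg : ∀ M ∈ (attPoly k p e u m a).support, p ^ (e + m) ≤ M.degree) :
    a = a attTop • attV k p e u m := by
  classical
  set d := p ^ (e + m) with hd
  set P := attPoly k p e u m a with hP
  have hpm : 0 < p ^ m := pow_pos hp.out.pos m
  -- degrees of the summands
  have hdegTop : (p ^ m • attW p e (attTop (p := p) (e := e))).degree = d := by
    rw [degree_nsmul, degree_attW_attTop, hd, pow_add, mul_comm]
  have hdegLt : ∀ i, i ≠ attTop → (p ^ m • attW p e i).degree < d := by
    intro i hi
    rw [degree_nsmul, hd, pow_add, mul_comm (p ^ e)]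
    have := degree_attW_lt hi
    exact (Nat.mul_lt_mul_left hpm).mpr (by omega)
  have htd : P.totalDegree ≤ d := by
    rw [hP]
    unfold attPoly
    refine (totalDegree_finsetSum _ _).trans (Finset.sup_le fun i _ => ?_)
    refine (totalDegree_mul _ _).trans ?_
    rw [totalDegree_C, zero_add]
    refine (totalDegree_pPlus_le u _).trans ?_
    by_cases hi : i = attTop
    · rw [hi, hdegTop]
    · exact (hdegLt i hi).le
  -- (1) `P` is its own degree-`d` component
  have hP1 : P = homogeneousComponent d P := by
    refine MvPolynomial.ext _ _ fun M => ?_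
    rw [coeff_homogeneousComponent]
    split_ifs with hM
    · rfl
    · by_contra hne
      have hmem : M ∈ P.support := mem_support_iff.mpr (Ne.symm hne ∘ Eq.symm)
      have h1 := hdeg M hmem
      have h2 : M.degree ≤ P.totalDegree := by
        have := le_totalDegree hmem
        rwa [Finsupp.degree_eq_sum, ← Finsupp.sum_fintype M (fun _ e => e) (fun _ => rfl)]
      exact hM (le_antisymm (h2.trans htd) h1)
  -- (2) the degree-`d` component is `a_{i*} X^{p^m W_{i*}}`
  have hP2 : homogeneousComponent d P = C (a attTop) * monomial (p ^ m • attW p e attTop) 1 := by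
    rw [hP]
    unfold attPoly
    rw [map_sum, Finset.sum_eq_single attTop]
    · rw [homogeneousComponent_C_mul, ← hdegTop, homogeneousComponent_pPlus]
    · intro i _ hi
      rw [homogeneousComponent_C_mul, homogeneousComponent_eq_zero, mul_zero]
      exact lt_of_le_of_lt (totalDegree_pPlus_le u _) (hdegLt i hi)
    · intro h; exact absurd (Finset.mem_univ _) h
  -- (3) substitute `X ↦ X − u` and compare coefficients at `p^m W_i`
  set σ := aeval (R := k) (fun l => (X l - C (u l) : MvPolynomial (Fin 2) k)) with hσ
  have hσP : σ P = ∑ i, monomial (p ^ m • attW p e i) (a i) := by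
    rw [hP]
    unfold attPoly
    rw [map_sum]
    refine Finset.sum_congr rfl fun i _ => ?_
    rw [map_mul, aeval_C, algebraMap_eq, aeval_sub_pPlus, C_mul_monomial, mul_one]
  have hσP' : σ P = C (a attTop) *
      σ (monomial (p ^ m • attW p e (attTop (p := p) (e := e))) (1 : k)) := by
    conv_lhs => rw [hP1, hP2]
    rw [map_mul, aeval_C, algebraMap_eq]
  funext i
  have hcoef := congrArg (coeff (p ^ m • attW p e i)) (hσP.symm.trans hσP')
  rw [coeff_sum, Finset.sum_eq_single i, coeff_monomial, if_pos rfl, coeff_C_mul] at hcoef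
  · rw [hcoef, Pi.smul_apply, smul_eq_mul]
    rfl
  · intro j _ hji
    rw [coeff_monomial, if_neg]
    intro h
    exact hji (attW_injective p e (smul_right_injective _ hpm.ne' h))
  · intro h; exact absurd (Finset.mem_univ i) h

/-- **`(L_B)_{e+m}(attP) ⊆ k · attV m`** for every `m ≥ 0`, over every field with a `p`-independent pair `u`.
[cite: Mizutani1973HironakaGroupSchemes, Remark 2.10 (e(H_e) = e, dim H_e = 2p^e − 1)] -/
theorem invForms_attP_le_span (hu : PIndep p 1 u) (he : 1 ≤ e) (m : ℕ) :
    invForms k p (attP k p e u) (e + m) ≤ Submodule.span k {attV k p e u m} := by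
  intro a ha
  rw [attKey m a (degree_le_of_mem_invForms hu he m ha)]
  exact Submodule.smul_mem _ _ (Submodule.mem_span_singleton_self _)

/-- Hence `dim_k (L_B)_{e+m}(attP) ≤ 1`. [cite: Mizutani1973HironakaGroupSchemes, Remark 2.10] -/
theorem finrank_invForms_attP_le_one (hu : PIndep p 1 u) (he : 1 ≤ e) (m : ℕ) :
    Module.finrank k (invForms k p (attP k p e u) (e + m)) ≤ 1 :=
  (Submodule.finrank_mono (invForms_attP_le_span hu he m)).trans (finrank_span_le_card ({attV k p e u m} : Set _)
    |>.trans (by rw [Set.toFinset_card, Set.card_singleton]))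

/-! ## Mizutani's relation `ω = t_0 t_1^{q−1}` and its coefficient vector `a⁰` -/

variable (k p e u) in
/-- The left coefficients `a⁰` of `ω = t_0 (1 ⊗ u_1 − u_1 ⊗ 1)^{q−1} = Σ_i a⁰_i ⊗ c_i`:
`a⁰_{(0,j)} = u_0 u_1^{q−1−j}`, `a⁰_{(1,j)} = −u_1^{q−1−j}`. [cite: Mizutani1973HironakaGroupSchemes, Remark 2.10 (in-house proof §10: ω = t_1 t_2^{q−1} has rank 2q)] -/
noncomputable def attA0 (i : Fin (attN p e + 1)) : k :=
  if (attIdx p e i).1 = 0 then u 0 * u 1 ^ (p ^ e - 1 - (attIdx p e i).2)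
  else -(u 1 ^ (p ^ e - 1 - (attIdx p e i).2))

omit [CharP k p] in
/-- `a⁰_{i*} = −1`. [folklore] -/
theorem attA0_attTop : attA0 k p e u attTop = -1 := by
  unfold attA0 attTop
  rw [Equiv.apply_symm_apply]
  simp

omit [CharP k p] in
/-- `a⁰ ≠ 0`. [folklore] -/
theorem attA0_ne_zero : attA0 k p e u ≠ 0 := by
  intro h
  have := congrFun h attTop
  rw [attA0_attTop, Pi.zero_apply] at this
  exact one_ne_zero (neg_eq_zero.mp this)

variable (k p e u) in
/-- The geometric sum `S = Σ_{j<q} u_1^{q−1−j} ⊗ u_1^j`. [folklore] -/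
noncomputable def attS : k ⊗[frobPow k p e] k :=
  ∑ j : Fin (p ^ e), (u 1 ^ (p ^ e - 1 - j)) ⊗ₜ[frobPow k p e] (u 1 ^ (j : ℕ))

/-- `β_0(a⁰) = (u_0 ⊗ 1 − 1 ⊗ u_0) · S` (verbatim encloser-1's computation, any field).
[cite: Mizutani1973HironakaGroupSchemes, Remark 2.10 (in-house proof §10)] -/
theorem attBeta_zero_attA0 : attBeta k p e u 0 (attA0 k p e u) =
    (u 0 ⊗ₜ[frobPow k p e] 1 - 1 ⊗ₜ[frobPow k p e] u 0) * attS k p e u := by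
  show (∑ i, attA0 k p e u i ⊗ₜ[frobPow k p e] (attC k p e u i ^ p ^ 0)) = _
  set L := frobPow k p e with hL
  unfold attS
  have hC : ∀ i, attC k p e u i ^ p ^ 0 = u 0 ^ ((attIdx p e i).1 : ℕ) * u 1 ^ ((attIdx p e i).2 : ℕ) := by
    intro i
    rw [pow_zero, pow_one]
    unfold attC
    rw [Fin.prod_univ_two, attW_zero, attW_one]
  simp_rw [hC]
  set g : Fin 2 × Fin (p ^ e) → k ⊗[L] k := fun x =>
    (if x.1 = 0 then u 0 * u 1 ^ (p ^ e - 1 - x.2) else -(u 1 ^ (p ^ e - 1 - x.2))) ⊗ₜ[L]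
      (u 0 ^ (x.1 : ℕ) * u 1 ^ (x.2 : ℕ)) with hg
  rw [Fintype.sum_equiv (attIdx p e)
      (fun i => attA0 k p e u i ⊗ₜ[L] (u 0 ^ ((attIdx p e i).1 : ℕ) * u 1 ^ ((attIdx p e i).2 : ℕ))) g
      (fun i => by rw [hg]; unfold attA0; rfl), Fintype.sum_prod_type g,
    Fin.sum_univ_two, ← Finset.sum_add_distrib, sub_mul, Finset.mul_sum, Finset.mul_sum, ← Finset.sum_sub_distrib]
  refine Finset.sum_congr rfl fun j _ => ?_
  rw [hg]
  simp only [Fin.isValue, ↓reduceIte, one_ne_zero, Fin.val_zero, pow_zero, one_mul,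
    Fin.val_one, pow_one, Algebra.TensorProduct.tmul_mul_tmul, TensorProduct.neg_tmul]
  rw [sub_eq_add_neg]

omit [CharP k p] in
/-- **`Σ_{j<q} X_0^{q−1−j} X_1^j = (X_1 − X_0)^{q−1}` in `k[X_0, X_1]`, `q = p^e`, `char k = p`** (multiply by
`X_1 − X_0`: both sides give `X_1^q − X_0^q = (X_1 − X_0)^q`; cancel in the domain). [folklore] -/
theorem geomSum_eq_sub_pow [CharP k p] : (∑ j : Fin (p ^ e), X 0 ^ (p ^ e - 1 - j) * X 1 ^ (j : ℕ)
      : MvPolynomial (Fin 2) k) = (X 1 - X 0) ^ (p ^ e - 1) := by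
  have hq : p ^ e = (p ^ e - 1) + 1 := (Nat.sub_add_cancel (Nat.one_le_pow _ _ hp.out.pos)).symm
  have hne : (X 1 - X 0 : MvPolynomial (Fin 2) k) ≠ 0 :=
    sub_ne_zero.mpr fun h => absurd (X_injective (σ := Fin 2) (R := k) h) (by decide)
  apply mul_right_cancel₀ hne
  have hgs := geom_sum₂_mul (X 1 : MvPolynomial (Fin 2) k) (X 0) (p ^ e)
  rw [Fin.sum_univ_eq_sum_range (fun j => (X 0 : MvPolynomial (Fin 2) k) ^ (p ^ e - 1 - j) * X 1 ^ j) (p ^ e)]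
  rw [show (∑ j ∈ Finset.range (p ^ e), (X 0 : MvPolynomial (Fin 2) k) ^ (p ^ e - 1 - j) * X 1 ^ j) =
      ∑ j ∈ Finset.range (p ^ e), X 1 ^ j * X 0 ^ (p ^ e - 1 - j) from
    Finset.sum_congr rfl fun j _ => mul_comm _ _, hgs, ← sub_pow_char_pow, ← pow_succ, ← hq]

/-- **`S = (1 ⊗ u_1 − u_1 ⊗ 1)^{q−1}`** in `k ⊗_{k^q} k` (the polynomial identity `geomSum_eq_sub_pow` evaluated at
`X_0 ↦ u_1 ⊗ 1`, `X_1 ↦ 1 ⊗ u_1`). [cite: Mizutani1973HironakaGroupSchemes, Remark 2.10 (in-house proof §1.2: t^{q−1})] -/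
theorem attS_eq : attS k p e u =
    ((1 : k) ⊗ₜ[frobPow k p e] u 1 - u 1 ⊗ₜ[frobPow k p e] 1) ^ (p ^ e - 1) := by
  set L := frobPow k p e with hL
  set φ := MvPolynomial.aeval (R := k) (S₁ := k ⊗[L] k) ![u 1 ⊗ₜ[L] 1, (1 : k) ⊗ₜ[L] u 1] with hφ
  have h0 : φ (X 0) = u 1 ⊗ₜ[L] 1 := by rw [hφ, aeval_X]; rfl
  have h1 : φ (X 1) = (1 : k) ⊗ₜ[L] u 1 := by rw [hφ, aeval_X]; rfl
  have key := congrArg φ (geomSum_eq_sub_pow (k := k) (p := p) (e := e))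
  rw [map_sum, map_pow, map_sub, h0, h1] at key
  rw [← key]
  unfold attS
  refine Finset.sum_congr rfl fun j _ => ?_
  rw [map_mul, map_pow, map_pow, h0, h1, Algebra.TensorProduct.tmul_pow, Algebra.TensorProduct.tmul_pow, one_pow,
    one_pow, Algebra.TensorProduct.tmul_mul_tmul, mul_one, one_mul]

/-- **`β_0(a⁰) ∈ J^q`**: `ω = t_0 · t_1^{q−1}` is a product of `q` elements of the diagonal ideal.
[cite: Mizutani1973HironakaGroupSchemes, Remark 2.10 (in-house proof §10: ω = t_1 t_2^{q−1} is genuine)] -/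
theorem attBeta_zero_attA0_mem :
    attBeta k p e u 0 (attA0 k p e u) ∈ KaehlerDifferential.ideal (frobPow k p e) k ^ p ^ e := by
  have hq : p ^ e = (p ^ e - 1) + 1 := (Nat.sub_add_cancel (Nat.one_le_pow _ _ hp.out.pos)).symm
  have hJ : KaehlerDifferential.ideal (frobPow k p e) k ^ p ^ e =
      KaehlerDifferential.ideal (frobPow k p e) k * KaehlerDifferential.ideal (frobPow k p e) k ^ (p ^ e - 1) := by
    conv_lhs => rw [hq]
    rw [pow_succ']
  rw [attBeta_zero_attA0, attS_eq, hJ]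
  refine Ideal.mul_mem_mul ?_ (Ideal.pow_mem_pow (KaehlerDifferential.one_smul_sub_smul_one_mem_ideal _ _) _)
  have := KaehlerDifferential.one_smul_sub_smul_one_mem_ideal (frobPow k p e) (u 0)
  rw [← neg_sub]
  exact Submodule.neg_mem _ this

/-- **`a⁰ ∈ (L_B)_e(attP)`** (any field). [cite: Mizutani1973HironakaGroupSchemes, Remark 2.10 (H_e has a nonzero invariant additive form of level e)] -/
theorem attA0_mem_invForms : attA0 k p e u ∈ invForms k p (attP k p e u) e :=
  (mem_invForms_attP_iff 0 (attA0 k p e u)).mpr attBeta_zero_attA0_mem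

/-- **`dim_k (L_B)_e(attP) = 1`** over every field with a `p`-independent pair `u`.
[cite: Mizutani1973HironakaGroupSchemes, Remark 2.10 (dim H_e = 2p^e − 1)] -/
theorem finrank_invForms_attP (hu : PIndep p 1 u) (he : 1 ≤ e) :
    Module.finrank k (invForms k p (attP k p e u) e) = 1 := by
  refine le_antisymm (finrank_invForms_attP_le_one hu he 0) ?_
  have hle : Submodule.span k {attA0 k p e u} ≤ invForms k p (attP k p e u) e := by
    rw [Submodule.span_le, Set.singleton_subset_iff]
    exact attA0_mem_invForms
  have := Submodule.finrank_mono hle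
  rwa [finrank_span_singleton attA0_ne_zero] at this

end Key

end Summit.ResolutionOfSingularities.KangarooAtlas.Mizutani.GenAtt
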